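import Summits.Ventures.QEC.Census.CNFEncodeXor
import HarnessLib

/-!
# Reduced fibre instances for budget-1 words (CDX, qec-cdx-eng-1): drop the null coordinates

For a budget-1 fibre instance `SolvesAny n rows [u] w` whose coordinates `≥ n₀` are the NULL columns, the two shapes consumed by
qec-cdx-type-1's `Fibre.Leaf.not_realised_of_nullSplit`,
* `h0`: no solution with every null false, and
* `hc c`: no solution with null `c` true and every other null false,
follow from the infeasibility of REDUCED instances over the group coordinates `0 … n₀−1` only:
`reduceRows0 rows n₀` (each row restricted to `< n₀`) at weight `w`, resp. `reduceRowsAt rows n₀ c u` (rows through `c` get `u`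
appended — their restricted part must be ODD, which the even row `restricted ++ u` says since `u` is odd) at weight `w − 1`.
The reduced instances have `n₀ ≈ 130` coordinates instead of `≈ 780`, so their enc-v1 CNFs and kernel replays are small.
Pure list/parity reasoning over `lparity` and `weight`; nothing about a code.
-/

namespace Summit.Ventures.QEC.CircuitDistance

open Summit.Ventures.QEC.Census.CNFEncode

/-- Rows restricted to the coordinates `< n₀`. -/
def reduceRows0 (rows : List (List ℕ)) (n0 : ℕ) : List (List ℕ) := rows.map fun r => r.filter fun x => decide (x < n0)

/-- Rows restricted to `< n₀`; a row containing the selected null `c` gets the odd group `u` appended. -/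
def reduceRowsAt (rows : List (List ℕ)) (n0 c : ℕ) (u : List ℕ) : List (List ℕ) :=
  rows.map fun r => if c ∈ r then (r.filter fun x => decide (x < n0)) ++ u else r.filter fun x => decide (x < n0)

/-- Parity of a row all of whose entries `≥ n₀` are false equals the parity of its restriction. -/
theorem lparity_filter_lt (a : ℕ → Bool) (n0 : ℕ) :
    ∀ r : List ℕ, (∀ x ∈ r, n0 ≤ x → a x = false) → lparity a (r.filter fun x => decide (x < n0)) = lparity a r
  | [], _ => rfl
  | x :: xs, h => by
    have hxs := lparity_filter_lt a n0 xs (fun y hy => h y (by simp [hy]))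
    simp only [List.filter_cons, lparity]
    by_cases hx : x < n0
    · simp [hx, lparity, hxs]
    · have : a x = false := h x (by simp) (Nat.le_of_not_lt hx)
      simp [hx, hxs, this]

/-- Parity of a row whose entries `≥ n₀` are false except `c` (true, occurring once): restriction has the opposite parity. -/
theorem lparity_filter_lt_except (a : ℕ → Bool) (n0 c : ℕ) (hc : n0 ≤ c) (hac : a c = true) :
    ∀ r : List ℕ, r.Nodup → c ∈ r → (∀ x ∈ r, n0 ≤ x → x ≠ c → a x = false) →
      lparity a (r.filter fun x => decide (x < n0)) = !(lparity a r)
  | [], _, hcr, _ => by simp at hcr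
  | x :: xs, hnd, hcr, h => by
    rw [List.nodup_cons] at hnd
    simp only [List.filter_cons, lparity]
    by_cases hxc : x = c
    · subst hxc
      have hnlt : ¬ x < n0 := Nat.not_lt.2 hc
      have hrest := lparity_filter_lt a n0 xs (fun y hy hy0 => h y (by simp [hy]) hy0 (fun e => hnd.1 (e ▸ hy)))
      simp [hnlt, hrest, hac]
    · have hcx : c ∈ xs := by simpa [Ne.symm hxc] using hcr
      have ih := lparity_filter_lt_except a n0 c hc hac xs hnd.2 hcx (fun y hy hy0 hyc => h y (by simp [hy]) hy0 hyc)
      by_cases hx : x < n0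
      · simp [hx, lparity, ih]
      · have : a x = false := h x (by simp) (Nat.le_of_not_lt hx) hxc
        simp [hx, ih, this]

/-- `weight` is monotone in the range. -/
theorem weight_mono (a : ℕ → Bool) {n0 n : ℕ} (h : n0 ≤ n) : weight a n0 ≤ weight a n := by
  unfold weight
  obtain ⟨k, rfl⟩ := Nat.exists_eq_add_of_le h
  rw [List.range_add, List.countP_append]
  omega

/-- If some coordinate `c ∈ [n₀, n)` is true, the weight on `[0,n)` exceeds the weight on `[0,n₀)`. -/
theorem weight_lt_of_true (a : ℕ → Bool) {n0 n c : ℕ} (h0 : n0 ≤ c) (hn : c < n) (hac : a c = true) :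
    weight a n0 + 1 ≤ weight a n := by
  unfold weight
  obtain ⟨k, rfl⟩ := Nat.exists_eq_add_of_le (show n0 ≤ n by omega)
  rw [List.range_add, List.countP_append]
  have : 1 ≤ (List.map (fun x => n0 + x) (List.range k)).countP fun i => a i := by
    apply Nat.succ_le_of_lt
    apply List.countP_pos_iff.2
    exact ⟨c, List.mem_map.2 ⟨c - n0, List.mem_range.2 (by omega), by omega⟩, by simpa using hac⟩
  omega

/-- **`h0` from the reduced instance**: rows restricted to the group coordinates, same weight. -/
theorem h0_of_reduced {n n0 : ℕ} {rows : List (List ℕ)} {u : List ℕ} {w : ℕ} (nulls : List ℕ) (hn : n0 ≤ n)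
    (hrows : ∀ r ∈ rows, ∀ x ∈ r, n0 ≤ x → x ∈ nulls)
    (hred : ¬ ∃ a, SolvesAny n0 (reduceRows0 rows n0) [u] w a) :
    ¬ ∃ a, SolvesAny n rows [u] w a ∧ ∀ c ∈ nulls, a c = false := by
  rintro ⟨a, ⟨hr, hu, hw⟩, hnull⟩
  refine hred ⟨a, ?_, hu, le_trans (weight_mono a hn) hw⟩
  intro r' hr'
  obtain ⟨r, hrm, rfl⟩ := List.mem_map.1 hr'
  rw [lparity_filter_lt a n0 r (fun x hx hx0 => hnull x (hrows r hrm x hx hx0))]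
  exact hr r hrm

/-- **`hc c` from the reduced instance**: rows through `c` made odd via `++ u`, weight `w − 1`. -/
theorem hc_of_reduced {n n0 : ℕ} {rows : List (List ℕ)} {u : List ℕ} {w : ℕ} (nulls : List ℕ) (c : ℕ)
    (hc0 : n0 ≤ c) (hcn : c < n) (hnd : ∀ r ∈ rows, r.Nodup)
    (hrows : ∀ r ∈ rows, ∀ x ∈ r, n0 ≤ x → x ∈ nulls)
    (hred : ¬ ∃ a, SolvesAny n0 (reduceRowsAt rows n0 c u) [u] (w - 1) a) :
    ¬ ∃ a, SolvesAny n rows [u] w a ∧ a c = true ∧ ∀ c' ∈ nulls, c' ≠ c → a c' = false := by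
  rintro ⟨a, ⟨hr, hu, hw⟩, hac, hnull⟩
  have hu1 : lparity a u = true := by
    obtain ⟨u', hu', hodd⟩ := hu
    rw [List.mem_singleton] at hu'; subst hu'; exact hodd
  refine hred ⟨a, ?_, hu, ?_⟩
  · intro r' hr'
    obtain ⟨r, hrm, rfl⟩ := List.mem_map.1 hr'
    by_cases hcr : c ∈ r
    · rw [if_pos hcr, lparity_append, lparity_filter_lt_except a n0 c hc0 hac r (hnd r hrm) hcr
        (fun x hx hx0 hxc => hnull x (hrows r hrm x hx hx0) hxc), hr r hrm, hu1]
      rfl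
    · rw [if_neg hcr, lparity_filter_lt a n0 r (fun x hx hx0 => hnull x (hrows r hrm x hx hx0) (fun e => hcr (e ▸ hx)))]
      exact hr r hrm
  · have := weight_lt_of_true a hc0 hcn hac
    omega

/-! ### Decidable side conditions in kernel-cheap Boolean form -/

/-- Reduced rows mention only coordinates `< n₀`. -/
theorem reduceRows0_lt (rows : List (List ℕ)) (n0 : ℕ) : ∀ r ∈ reduceRows0 rows n0, ∀ i ∈ r, i < n0 := by
  intro r hr i hi
  obtain ⟨r0, -, rfl⟩ := List.mem_map.1 hr
  simpa using (List.mem_filter.1 hi).2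

/-- Reduced rows (selected-null form) mention only coordinates `< n₀` when `u` does. -/
theorem reduceRowsAt_lt (rows : List (List ℕ)) (n0 c : ℕ) (u : List ℕ) (hu : ∀ i ∈ u, i < n0) :
    ∀ r ∈ reduceRowsAt rows n0 c u, ∀ i ∈ r, i < n0 := by
  intro r hr i hi
  obtain ⟨r0, -, rfl⟩ := List.mem_map.1 hr
  by_cases h : c ∈ r0
  · rw [if_pos h] at hi
    rcases List.mem_append.1 hi with hi | hi
    · simpa using (List.mem_filter.1 hi).2
    · exact hu i hi
  · rw [if_neg h] at hi
    simpa using (List.mem_filter.1 hi).2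

/-- «every row entry is a group coordinate or a null» from one Boolean computation. -/
theorem rows_nulls_of_all (rows : List (List ℕ)) (nulls : List ℕ) (n0 : ℕ)
    (h : (rows.all fun r => r.all fun x => decide (x < n0) || nulls.contains x) = true) :
    ∀ r ∈ rows, ∀ x ∈ r, n0 ≤ x → x ∈ nulls := by
  intro r hr x hx hx0
  have := List.all_eq_true.1 (List.all_eq_true.1 h r hr) x hx
  rw [Bool.or_eq_true] at this
  rcases this with h1 | h1
  · have : x < n0 := by simpa using h1
    omega
  · simpa using h1

/-- Row duplicate-freeness from one Boolean computation. -/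
theorem nodup_of_all (rows : List (List ℕ)) (h : (rows.all fun r => decide r.Nodup) = true) : ∀ r ∈ rows, r.Nodup := by
  intro r hr
  simpa using List.all_eq_true.1 h r hr

/-- Singleton-`us` coordinate bound from one Boolean computation. -/
theorem us_lt_of_all (u : List ℕ) (n0 : ℕ) (h : (u.all fun i => decide (i < n0)) = true) : ∀ v ∈ [u], ∀ i ∈ v, i < n0 := by
  intro v hv i hi
  rw [List.mem_singleton] at hv; subst hv
  simpa using List.all_eq_true.1 h i hi

end Summit.Ventures.QEC.CircuitDistance
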